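import Summits.BirchSwinnertonDyer.BirchSwinnertonDyer.Theorems.PrintCf2SplitBadTwoLocalTorsionCountAtV
import Summits.BirchSwinnertonDyer.BirchSwinnertonDyer.Theorems.PrintCf2SplitBadTwoLocalLineCountFrame
import Mathlib.NumberTheory.Padics.RingHoms
import HarnessLib

/-!
# Crux `PrintCf2.SplitBadTwoRankOneOfFacts` (stmt-BirchSwinnertonDyer-20368), road α v10.3, S3c factor (F3):
# THE POINT INDEX AT `v` — `[E(K_v) : ℤ·P + E[2] + 2^N E(K_v)] = 2^ℓ` on the frame (the `ℤP + torsion` core of -w8 g3's plain road)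

Cell `bsd-print-cf2`, width seat `bsd-line-cf2-p1-w2` g11; `--supports stmt-BirchSwinnertonDyer-20368` (helper, Theses-free).
HONEST FRAMING: nothing here closes a crux or a stub; BSD is not proved by any of this; no summit statement is proved by this seat.
No definition, no named fact, no `sorry`, no kit. beyond-print theorem: no (bookkeeping).

WHY. -w8 g3's plain road to (F3) (p677570 / p678401 / `…KummerOutsideLevelLift`) ends in `#range(loc_v | 𝔖_v̄(K,W*)) = [E(K_v) : E(K) + 2^k E(K_v)]`
at every deep level; the S3c value of (F3) is then the POINT INDEX `[E(K_v) : E(K) + 2^k E(K_v)] = 2^ℓ`. THIS FILE proves its `ℤ·P + torsion` core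
(the `𝒪_K`-multiples of `P` add nothing locally — -w3 g10's CM-scalar line — and the identification with `E(K)`'s image are NOT done here):
* §1 `natCard_quotient_range_nsmul_eq` — for `G ⊇ U ≃+ ℤ_p` of finite index and every `N`:
  `#(G ⧸ p^N G) = p^N · #G[p^N]` (coordinate `ξ : G ↠ ℤ_p` of p676822: `G/(p^N G + G_tors) ≅ ℤ/p^N` and `[G_tors : p^N G ∩ G_tors] = #G[p^N]`);
* §2 `index_zmultiples_sup_sup_range_nsmul_mul` — with `x₀` of exact depth `D` and a `p^a`-torsion subgroup `C`:
  `[G : ℤx₀ + C + p^N G] · #C = p^D · #G[p^N]` (p676822 `natCard_map_zmultiples_sup_eq` with `W = ⊥`);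
* §3 **`index_zmultiples_toPadicPoint_sup_sup_range_eq`** — S3c frame, `ℚ₂`-currency: for every 2-power-torsion `C ≤ W(ℚ₂)` with `#C = 4`
  (`= E[2]`): `∃ N₀, ∀ N ≥ N₀, [W(ℚ₂) : ℤ·P₂ + C + 2^N W(ℚ₂)] = 2^{ℓ.toNat}` (depth `ℓ.toNat − [d%8=3]`, -w6 g3 p675150; `#W(ℚ₂)[2^∞] =
  2^{2+[d%8=3]}`, -w4 g6; the two `[d ≡ 3 (8)]` CANCEL);
* §4 **`index_zmultiples_sup_sup_range_eq_of_frame`** — the same in `E(K_v) = ((W_K) ⊗ K_v)(K_v)` for `x₀ :=` the point `P` with its rational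
  coordinates read in `K_v` (`Affine.Point.congrEquiv` of `Affine.Point.map (Algebra.ofId ℚ K_v) P`), via `exists_pointEquiv_apply_toPadicPoint`
  (the transport of p678984 maps `toPadicPoint 2 Q ↦` that point, for every `Q ∈ W(ℚ)`).

References: J. H. Silverman, *AEC* 2nd ed. (2009), Prop. VII.6.3, VIII §1 [SilvermanAEC2009]; A. Agboola, Compositio 143 (2007) §6
Prop. 6.10–6.11 [Agboola2007]; J. Neukirch, *ANT* (1999) II (8.5) [NeukirchANT1999].
-/

noncomputable section

open scoped Classical

set_option linter.dupNamespace false -- `Summit.BirchSwinnertonDyer.BirchSwinnertonDyer` (summit = problem) is the tree's layout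
set_option autoImplicit false

open NumberField IsDedekindDomain Field WeierstrassCurve
open Literature.NumberTheory.EllipticCurves

namespace Summit.BirchSwinnertonDyer.BirchSwinnertonDyer.Theorems.PrintCf2.LocalLineCount

open Summit.BirchSwinnertonDyer.BirchSwinnertonDyer.Theorems.PrintCf2.DyadicTorsion

/-! ## §1. `#(G ⧸ p^N G) = p^N · #G[p^N]` for `G ⊇ U ≃+ ℤ_p` -/

section Generic

variable {G : Type*} [AddCommGroup G] {p : ℕ} [hp : Fact p.Prime]

/-- The torsion of `G ⊇ U ≃+ ℤ_p` (finite index), i.e. the kernel of a coordinate with kernel the torsion, is FINITE (it embeds in `G ⧸ U`).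
[folklore] -/
theorem finite_ker_of_coord (U : AddSubgroup G) [U.FiniteIndex] (e : U ≃+ ℤ_[p]) {ξ : G →+ ℤ_[p]}
    (hker : ∀ x, ξ x = 0 ↔ IsOfFinAddOrder x) : Finite ξ.ker := by
  let j : ξ.ker → G ⧸ U := fun t ↦ QuotientAddGroup.mk (t : G)
  refine Finite.of_injective j fun a b hab ↦ ?_
  have hmem : -(a : G) + (b : G) ∈ U := QuotientAddGroup.eq.mp hab
  have htor : IsOfFinAddOrder (-(a : G) + (b : G)) :=
    (isOfFinAddOrder_neg_iff.mpr ((hker _).mp a.2)).add ((hker _).mp b.2)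
  have h0 : U.index • (-(a : G) + (b : G)) = 0 := index_nsmul_eq_zero_of_isOfFinAddOrder U e htor
  have hU0 : (⟨-(a : G) + (b : G), hmem⟩ : U) = 0 := by
    have h1 : U.index • e ⟨-(a : G) + (b : G), hmem⟩ = 0 := by
      rw [← map_nsmul]; exact (congrArg e (Subtype.ext h0)).trans (map_zero e)
    rcases smul_eq_zero.mp h1 with h | h
    · exact absurd h AddSubgroup.FiniteIndex.index_ne_zero
    · exact e.map_eq_zero_iff.mp h
  apply Subtype.ext
  have : -(a : G) + (b : G) = 0 := congrArg Subtype.val hU0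
  rw [neg_add_eq_zero] at this
  exact this

/-- **`#(G ⧸ p^N G) = p^N · #G[p^N]`.** For `G ⊇ U ≃+ ℤ_p` of finite index and every `N`: the quotient by `p^N G` has exactly
`p^N · #G[p^N]` elements (`G/(p^N G + G_tors) ≅ ℤ/p^N` through the coordinate of p676822, and
`[G_tors : G_tors ∩ p^N G] = [G_tors : p^N G_tors] = #G_tors[p^N] = #G[p^N]`, kernel and cokernel of `p^N •` on the finite group `G_tors`).
[folklore] [cite: SilvermanAEC2009, Prop. VII.6.3] -/
theorem natCard_quotient_range_nsmul_eq (U : AddSubgroup G) [U.FiniteIndex] (e : U ≃+ ℤ_[p]) (N : ℕ) :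
    Nat.card (G ⧸ (nsmulAddMonoidHom (p ^ N) : G →+ G).range) = p ^ N * Nat.card (nsmulAddMonoidHom (p ^ N) : G →+ G).ker := by
  obtain ⟨ξ, hsurj, hker⟩ := exists_surjective_coord U e
  haveI hTfin : Finite ξ.ker := finite_ker_of_coord U e hker
  set R : AddSubgroup G := (nsmulAddMonoidHom (p ^ N) : G →+ G).range with hR
  set T : AddSubgroup G := ξ.ker with hT
  -- (i) `G ⧸ (R ⊔ T) ≅ ℤ/p^N` through `toZModPow N ∘ ξ`
  let f : G →+ ZMod (p ^ N) := (PadicInt.toZModPow N : ℤ_[p] →+* ZMod (p ^ N)).toAddMonoidHom.comp ξ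
  have hfsurj : Function.Surjective f :=
    (ZMod.ringHom_surjective (PadicInt.toZModPow N : ℤ_[p] →+* ZMod (p ^ N))).comp hsurj
  have hfker : f.ker = R ⊔ T := by
    ext g
    rw [AddMonoidHom.mem_ker, AddSubgroup.mem_sup]
    change PadicInt.toZModPow N (ξ g) = 0 ↔ _
    rw [← RingHom.mem_ker, PadicInt.ker_toZModPow, Ideal.mem_span_singleton, ← exists_add_torsion_iff_dvd hsurj hker g N]
    constructor
    · rintro ⟨y, t, ht, hyt⟩
      exact ⟨p ^ N • y, ⟨y, rfl⟩, t, (hker t).mpr ht, hyt⟩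
    · rintro ⟨r, ⟨y, rfl⟩, t, ht, hyt⟩
      exact ⟨y, t, (hker t).mp ht, hyt⟩
  have hcardQ : Nat.card (G ⧸ (R ⊔ T)) = p ^ N := by
    rw [← hfker, Nat.card_congr (QuotientAddGroup.quotientKerEquivOfSurjective f hfsurj).toEquiv, Nat.card_zmod]
  -- (ii) `[T : R ⊓ T] = #G[p^N]` through the endomorphism `t ↦ p^N t` of the finite group `T`
  let φ : T →+ T := (nsmulAddMonoidHom (p ^ N) : T →+ T)
  have hφrange : φ.range = R.addSubgroupOf T := by
    ext t
    rw [AddSubgroup.mem_addSubgroupOf, AddMonoidHom.mem_range]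
    constructor
    · rintro ⟨s, rfl⟩
      exact ⟨(s : G), by simp [φ]⟩
    · rintro ⟨g, hg⟩
      have hgT : g ∈ T := by
        rw [hT, AddMonoidHom.mem_ker]
        have h1 : (p : ℤ_[p]) ^ N * ξ g = 0 := by
          have := congrArg ξ hg
          rw [nsmulAddMonoidHom_apply, map_nsmul, nsmul_eq_mul, Nat.cast_pow] at this
          rw [this]; exact t.2
        rcases mul_eq_zero.mp h1 with h | h
        · exact absurd h (pow_ne_zero _ (by exact_mod_cast hp.out.ne_zero))
        · exact h
      exact ⟨⟨g, hgT⟩, Subtype.ext (by simpa [φ] using hg)⟩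
  have hφker : Nat.card φ.ker = Nat.card (nsmulAddMonoidHom (p ^ N) : G →+ G).ker := by
    refine Nat.card_congr ⟨fun t ↦ ⟨(t.1 : G), ?_⟩, fun g ↦ ⟨⟨g.1, ?_⟩, ?_⟩, fun t ↦ ?_, fun g ↦ ?_⟩
    · have h : p ^ N • (t.1 : T) = 0 := (AddMonoidHom.mem_ker).mp t.2
      have h' := congrArg Subtype.val h
      rw [AddMonoidHom.mem_ker, nsmulAddMonoidHom_apply]
      simpa only [AddSubgroupClass.coe_nsmul, ZeroMemClass.coe_zero] using h'
    · change (g.1 : G) ∈ ξ.ker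
      rw [AddMonoidHom.mem_ker, hker]
      exact isOfFinAddOrder_iff_nsmul_eq_zero.mpr ⟨p ^ N, Nat.pos_of_ne_zero (pow_ne_zero _ hp.out.ne_zero),
        (AddMonoidHom.mem_ker).mp g.2⟩
    · rw [AddMonoidHom.mem_ker]
      apply Subtype.ext
      have h := (AddMonoidHom.mem_ker).mp g.2
      rw [nsmulAddMonoidHom_apply] at h
      rw [nsmulAddMonoidHom_apply, AddSubgroupClass.coe_nsmul, ZeroMemClass.coe_zero]
      exact h
    · rfl
    · rfl
  have hTsplit : Nat.card T = Nat.card φ.ker * Nat.card φ.range := by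
    rw [φ.ker.card_eq_card_quotient_mul_card_addSubgroup, Nat.card_congr (QuotientAddGroup.quotientKerEquivRange φ).toEquiv, mul_comm]
  have hrel : R.relIndex T = Nat.card (nsmulAddMonoidHom (p ^ N) : G →+ G).ker := by
    rw [AddSubgroup.relIndex, ← hφrange, ← hφker]
    have h1 : φ.range.index * Nat.card φ.range = Nat.card T := φ.range.index_mul_card
    rw [hTsplit] at h1
    exact Nat.eq_of_mul_eq_mul_right Nat.card_pos h1
  -- (iii) assemble: `[G : R] = [G : R ⊔ T] · [R ⊔ T : R]`
  have hidx : R.index = R.relIndex (R ⊔ T) * (R ⊔ T).index := (AddSubgroup.relIndex_mul_index le_sup_left).symm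
  rw [← AddSubgroup.index_eq_card, hidx, AddSubgroup.relIndex_sup_left, hrel, AddSubgroup.index_eq_card, hcardQ, mul_comm]

/-- **`[G : ℤx₀ + C + p^N G] · #C = p^D · #G[p^N]`** for `x₀` of exact depth `D`, `C` a `p^a`-torsion subgroup, `N ≥ D + a`
(p676822 `natCard_map_zmultiples_sup_eq` with `W = ⊥` and §1). [folklore] [cite: SilvermanAEC2009, Prop. VII.6.3] -/
theorem index_zmultiples_sup_sup_range_nsmul_mul (U : AddSubgroup G) [U.FiniteIndex] (e : U ≃+ ℤ_[p])
    {a b : ℕ} (hb : ¬ p ∣ b) (htors : ∀ t : G, IsOfFinAddOrder t → (p ^ a * b) • t = 0)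
    {x₀ : G} {D N : ℕ} (hN : D + a ≤ N)
    (hD : ∃ y t : G, IsOfFinAddOrder t ∧ p ^ D • y + t = x₀)
    (hD' : ¬ ∃ y t : G, IsOfFinAddOrder t ∧ p ^ (D + 1) • y + t = x₀)
    (C : AddSubgroup G) (hC : ∀ c ∈ C, p ^ a • c = 0) :
    ((AddSubgroup.zmultiples x₀ ⊔ C) ⊔ (nsmulAddMonoidHom (p ^ N) : G →+ G).range).index * Nat.card C =
      p ^ D * Nat.card (nsmulAddMonoidHom (p ^ N) : G →+ G).ker := by
  set R : AddSubgroup G := (nsmulAddMonoidHom (p ^ N) : G →+ G).range with hR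
  have hK : ∀ k, k ∈ R ↔ ∃ y w : G, w ∈ (⊥ : AddSubgroup G) ∧ p ^ N • y + w = k := by
    intro k
    rw [hR, AddMonoidHom.mem_range]
    constructor
    · rintro ⟨y, rfl⟩; exact ⟨y, 0, (⊥ : AddSubgroup G).zero_mem, by rw [add_zero]; rfl⟩
    · rintro ⟨y, w, hw, rfl⟩; exact ⟨y, by rw [(AddSubgroup.mem_bot).mp hw, add_zero]; rfl⟩
  have hcount := natCard_map_zmultiples_sup_eq U e hb htors hN hD hD' ⊥ C R (fun w hw ↦ by rw [(AddSubgroup.mem_bot).mp hw, smul_zero])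
    hC (disjoint_bot_right) hK
  have hQ := natCard_quotient_range_nsmul_eq U e N
  -- index of `S = (ℤx₀ ⊔ C) ⊔ R` through the quotient by `R`
  have hsurj : Function.Surjective (QuotientAddGroup.mk' R) := QuotientAddGroup.mk'_surjective R
  have hkerle : (QuotientAddGroup.mk' R).ker ≤ (AddSubgroup.zmultiples x₀ ⊔ C) ⊔ R := by
    rw [QuotientAddGroup.ker_mk']; exact le_sup_right
  have hmap : ((AddSubgroup.zmultiples x₀ ⊔ C) ⊔ R).map (QuotientAddGroup.mk' R) =
      (AddSubgroup.zmultiples x₀ ⊔ C).map (QuotientAddGroup.mk' R) := by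
    have hR0 : R.map (QuotientAddGroup.mk' R) = ⊥ := (AddSubgroup.map_eq_bot_iff _).mpr (by rw [QuotientAddGroup.ker_mk'])
    rw [AddSubgroup.map_sup, hR0, sup_bot_eq]
  have hidx : ((AddSubgroup.zmultiples x₀ ⊔ C) ⊔ R).index =
      ((AddSubgroup.zmultiples x₀ ⊔ C).map (QuotientAddGroup.mk' R)).index := by
    rw [← hmap, AddSubgroup.index_map_eq _ hsurj hkerle]
  have hprod := ((AddSubgroup.zmultiples x₀ ⊔ C).map (QuotientAddGroup.mk' R)).index_mul_card
  rw [hcount, hQ] at hprod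
  rw [hidx]
  have hpow : p ^ N = p ^ D * p ^ (N - D) := by rw [← pow_add]; congr 1; omega
  apply Nat.eq_of_mul_eq_mul_right (Nat.pos_of_ne_zero (pow_ne_zero (N - D) hp.out.ne_zero))
  calc ((AddSubgroup.zmultiples x₀ ⊔ C).map (QuotientAddGroup.mk' R)).index * Nat.card C * p ^ (N - D)
      = ((AddSubgroup.zmultiples x₀ ⊔ C).map (QuotientAddGroup.mk' R)).index * (p ^ (N - D) * Nat.card C) := by ring
    _ = p ^ N * Nat.card (nsmulAddMonoidHom (p ^ N) : G →+ G).ker := hprod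
    _ = p ^ D * Nat.card (nsmulAddMonoidHom (p ^ N) : G →+ G).ker * p ^ (N - D) := by rw [hpow]; ring

end Generic

/-! ## §3. The S3c frame in `ℚ₂`-currency -/

/-- **THE POINT INDEX, `ℚ₂`-currency.** On the S3c frame (`d` squarefree, `d ≢ 1 (4)`, `W` globally minimal, `C • W = E^{(d)}`, `P ∈ W(ℚ)`,
`c₀ ≠ 0`, `‖log_Ŵ(z(c₀P₂))/c₀‖ = 2^{−ℓ}`): there is `N₀` such that for all `N ≥ N₀` and every 2-power-torsion subgroup `C_t ≤ W(ℚ₂)` with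
`#C_t = 4` (i.e. `C_t = E[2]`): **`[W(ℚ₂) : ℤ·P₂ + C_t + 2^N W(ℚ₂)] = 2^{ℓ.toNat}`**. The depth `ℓ.toNat − [d ≡ 3 (8)]` (-w6 g3) and the torsion
count `#W(ℚ₂)[2^∞] = 2^{2+[d≡3 (8)]}` (-w4 g6) combine and the two `[d ≡ 3 (8)]` cancel.
[cite: SilvermanAEC2009, Prop. VII.6.3] [cite: Agboola2007, §6 Prop. 6.10–6.11] -/
theorem index_zmultiples_toPadicPoint_sup_sup_range_eq {d : ℤ} (hd : d ≠ 0) (hsq : Squarefree d) (hd4 : d % 4 ≠ 1)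
    (W : WeierstrassCurve ℚ) [W.IsElliptic] [W.IsGloballyMinimal] {C : VariableChange ℚ}
    (hC : C • W = cm7.quadraticTwist (d : ℚ)) {P : W.toAffine.Point} {c₀ : ℕ} {ℓ : ℤ} (hc₀ : c₀ ≠ 0)
    (hker : (W.baseChange ℚ_[2]).IsInReductionKernel (c₀ • W.toPadicPoint 2 P))
    (hℓ : ‖(W.baseChange ℚ_[2]).padicLogPoint (c₀ • W.toPadicPoint 2 P) / (c₀ : ℚ_[2])‖ = (2 : ℝ) ^ (-ℓ)) :
    ∃ N₀ : ℕ, ∀ N : ℕ, N₀ ≤ N → ∀ Ct : AddSubgroup (W.baseChange ℚ_[2]).toAffine.Point,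
      (∀ c ∈ Ct, ∃ k : ℕ, 2 ^ k • c = 0) → Nat.card Ct = 4 →
      ((AddSubgroup.zmultiples (W.toPadicPoint 2 P) ⊔ Ct) ⊔
          (nsmulAddMonoidHom (2 ^ N) : (W.baseChange ℚ_[2]).toAffine.Point →+ _).range).index = 2 ^ ℓ.toNat := by
  haveI : Fact (Nat.Prime 2) := ⟨Nat.prime_two⟩
  obtain ⟨U, hU, ⟨e⟩⟩ := exists_finiteIndex_addEquiv_padicInt_holds 2 (W.baseChange ℚ_[2])
  haveI := hU
  obtain ⟨a, b, hb, htors⟩ := exists_torsion_annihilator U e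
  set e8 : ℕ := if d % 8 = 3 then 1 else 0 with he8
  set D : ℕ := ℓ.toNat - e8 with hDdef
  have hD : ∃ y T : (W.baseChange ℚ_[2]).toAffine.Point, IsOfFinAddOrder T ∧ 2 ^ D • y + T = W.toPadicPoint 2 P :=
    (exists_pow_smul_add_torsion_iff_of_frame' hd hsq hd4 W hC hc₀ hker hℓ D).mpr le_rfl
  have hD' : ¬ ∃ y T : (W.baseChange ℚ_[2]).toAffine.Point, IsOfFinAddOrder T ∧ 2 ^ (D + 1) • y + T = W.toPadicPoint 2 P :=
    fun h ↦ absurd ((exists_pow_smul_add_torsion_iff_of_frame' hd hsq hd4 W hC hc₀ hker hℓ (D + 1)).mp h) (by omega)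
  have hel : (if d % 8 = 3 then (1 : ℤ) else 0) ≤ ℓ := le_ell_of_smul_eq_quadraticTwist d hd hsq hd4 W C hC P c₀ ℓ hc₀ hker hℓ
  have hℓD : ℓ.toNat = D + e8 := by
    rw [hDdef, he8]; split_ifs at hel ⊢ with h3 <;> omega
  -- the torsion count at deep level
  have hQ2 := natCard_primaryComponent_two_of_smul_eq_quadraticTwist hsq hd4 W hC
  have hpos : 0 < Nat.card (AddCommGroup.primaryComponent (W.baseChange ℚ_[2]).toAffine.Point 2) := by
    rw [hQ2]; split_ifs <;> norm_num
  haveI : Finite (AddCommGroup.primaryComponent (W.baseChange ℚ_[2]).toAffine.Point 2) := Nat.finite_of_card_ne_zero hpos.ne'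
  refine ⟨D + a + 3, fun N hN Ct hCt hcard ↦ ?_⟩
  have hdvd : Nat.card (AddCommGroup.primaryComponent (W.baseChange ℚ_[2]).toAffine.Point 2) ∣ 2 ^ N := by
    rw [hQ2]
    obtain ⟨k, rfl⟩ := Nat.exists_eq_add_of_le (show 3 ≤ N by omega)
    split_ifs
    · exact ⟨2 ^ k, by rw [pow_add]; norm_num⟩
    · exact ⟨2 * 2 ^ k, by rw [pow_add]; norm_num; ring⟩
  have hkerN : Nat.card (nsmulAddMonoidHom (2 ^ N) : (W.baseChange ℚ_[2]).toAffine.Point →+ _).ker = if d % 8 = 3 then 8 else 4 := by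
    rw [natCard_ker_nsmul_eq_of_natCard_primaryComponent 2 N hdvd, hQ2]
  have hC2 : ∀ c ∈ Ct, 2 ^ a • c = 0 := fun c hc ↦ by
    obtain ⟨k, hk⟩ := hCt c hc
    exact pow_nsmul_eq_zero_of_annihilator hb ⟨k, hk⟩
      (htors c (isOfFinAddOrder_iff_nsmul_eq_zero.mpr ⟨2 ^ k, Nat.pos_of_ne_zero (pow_ne_zero _ two_ne_zero), hk⟩))
  have hmain := index_zmultiples_sup_sup_range_nsmul_mul U e hb htors (x₀ := W.toPadicPoint 2 P) (N := N) (by omega) hD hD' Ct hC2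
  rw [hcard, hkerN] at hmain
  rw [hℓD, pow_add]
  -- `index · 4 = 2^D · (8 | 4)`
  have h4 : (0 : ℕ) < 4 := by norm_num
  rw [he8]
  split_ifs at hmain ⊢ with h3
  · have : ((AddSubgroup.zmultiples (W.toPadicPoint 2 P) ⊔ Ct) ⊔
        (nsmulAddMonoidHom (2 ^ N) : (W.baseChange ℚ_[2]).toAffine.Point →+ _).range).index * 4 = (2 ^ D * 2 ^ 1) * 4 := by
      rw [hmain]; ring
    exact Nat.eq_of_mul_eq_mul_right h4 this
  · have : ((AddSubgroup.zmultiples (W.toPadicPoint 2 P) ⊔ Ct) ⊔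
        (nsmulAddMonoidHom (2 ^ N) : (W.baseChange ℚ_[2]).toAffine.Point →+ _).range).index * 4 = (2 ^ D * 2 ^ 0) * 4 := by
      rw [hmain]; ring
    exact Nat.eq_of_mul_eq_mul_right h4 this

/-! ## §4. The S3c frame in `K_v`-currency -/

/-- **Point transport with its value on rational points**: for `W/ℚ`, fields `K ⊆ E` of characteristic `0` and a surjective `φ : ℚ_p →+* E`, there is
an additive isomorphism `Φ : W(ℚ_p) ≃+ ((W_K) ⊗ E)(E)` with `Φ (toPadicPoint p Q) =` the point `Q` with its rational coordinates read in `E`,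
for every `Q ∈ W(ℚ)`. [cite: SilvermanAEC2009, VIII §1] -/
theorem exists_pointEquiv_apply_toPadicPoint (W : WeierstrassCurve ℚ) (p : ℕ) [Fact p.Prime] (K : Type) [Field K] [CharZero K]
    (E : Type) [Field E] [Algebra ℚ E] [Algebra K E] [CharZero E] (φ : ℚ_[p] →+* E) (hφ : Function.Surjective φ)
    (hcurve : (W.baseChange K).baseChange E = W.baseChange E) :
    ∃ Φ : (W.baseChange ℚ_[p]).toAffine.Point ≃+ ((W.baseChange K).baseChange E).toAffine.Point,
      ∀ Q : W.toAffine.Point, Φ (W.toPadicPoint p Q) =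
        Affine.Point.congrEquiv hcurve.symm (Affine.Point.map (W' := W.toAffine) (Algebra.ofId ℚ E) Q) := by
  let ψ : ℚ_[p] →ₐ[ℚ] E := φ.toRatAlgHom
  have hψ : ∀ a, ψ a = φ a := fun _ ↦ rfl
  let F : (W.baseChange ℚ_[p]).toAffine.Point →+ (W.baseChange E).toAffine.Point := Affine.Point.map (W' := W.toAffine) ψ
  have hFinj : Function.Injective F := Affine.Point.map_injective (W' := W.toAffine) ψ
  have hFsurj : Function.Surjective F := by
    intro R
    rcases R with _ | ⟨a, b, h⟩
    · exact ⟨0, map_zero F⟩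
    · obtain ⟨a₀, rfl⟩ := hφ a
      obtain ⟨b₀, rfl⟩ := hφ b
      have h₀ : (W.baseChange ℚ_[p]).toAffine.Nonsingular a₀ b₀ :=
        (Affine.baseChange_nonsingular W (f := ψ) ψ.toRingHom.injective a₀ b₀).mp (by rw [hψ, hψ]; exact h)
      exact ⟨Affine.Point.some a₀ b₀ h₀, by
        change Affine.Point.map ψ (Affine.Point.some a₀ b₀ h₀) = _
        rw [Affine.Point.map_some]; exact Affine.Point.some_eq_some_of_eq (hψ a₀) (hψ b₀)⟩
  refine ⟨(AddEquiv.ofBijective F ⟨hFinj, hFsurj⟩).trans (Affine.Point.congrEquiv hcurve.symm), fun Q ↦ ?_⟩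
  change Affine.Point.congrEquiv hcurve.symm (Affine.Point.map ψ (Affine.Point.map (Algebra.ofId ℚ ℚ_[p]) Q)) = _
  rw [Affine.Point.map_map, Subsingleton.elim (ψ.comp (Algebra.ofId ℚ ℚ_[p])) (Algebra.ofId ℚ E)]

/-- **THE POINT INDEX AT A DEGREE-ONE PLACE, `E`-currency** (`E ≅ ℚ₂`, e.g. `E = K_v` on the S3c frame via -w6 g3
`exists_surjective_padic_adicCompletion`). With `x₀ :=` the point `P` with its rational coordinates read in `E` (an element of
`((W_K) ⊗ E)(E)`): there is `N₀` such that for all `N ≥ N₀` and every 2-power-torsion subgroup `C_t` with `#C_t = 4`: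
**`[((W_K) ⊗ E)(E) : ℤ·x₀ + C_t + 2^N · ((W_K) ⊗ E)(E)] = 2^{ℓ.toNat}`** — the `ℤP + E[2]` core of the point index `[E(K_v) : E(K) + 2^N E(K_v)] = 2^ℓ`
of -w8 g3's road. (Instantiate `E := v.adicCompletion K` with the `Algebra ℚ` instance of your statement; `hcurve` is `map_map` + `Subsingleton.elim`.)
[cite: SilvermanAEC2009, Prop. VII.6.3 and VIII §1] [cite: Agboola2007, §6 Prop. 6.10–6.11] [cite: NeukirchANT1999, Ch. II (8.5)] -/
theorem index_zmultiples_sup_sup_range_eq_of_surjective {d : ℤ} (hd : d ≠ 0) (hsq : Squarefree d) (hd4 : d % 4 ≠ 1)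
    (W : WeierstrassCurve ℚ) [W.IsElliptic] [W.IsGloballyMinimal] {C : VariableChange ℚ}
    (hC : C • W = cm7.quadraticTwist (d : ℚ)) (K : Type) [Field K] [CharZero K]
    (E : Type) [Field E] [Algebra ℚ E] [Algebra K E] [CharZero E] (φ : ℚ_[2] →+* E) (hφ : Function.Surjective φ)
    (hcurve : (W.baseChange K).baseChange E = W.baseChange E)
    {P : W.toAffine.Point} {c₀ : ℕ} {ℓ : ℤ} (hc₀ : c₀ ≠ 0)
    (hker : (W.baseChange ℚ_[2]).IsInReductionKernel (c₀ • W.toPadicPoint 2 P))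
    (hℓ : ‖(W.baseChange ℚ_[2]).padicLogPoint (c₀ • W.toPadicPoint 2 P) / (c₀ : ℚ_[2])‖ = (2 : ℝ) ^ (-ℓ)) :
    ∃ N₀ : ℕ, ∀ N : ℕ, N₀ ≤ N → ∀ Ct : AddSubgroup ((W.baseChange K).baseChange E).toAffine.Point,
      (∀ c ∈ Ct, ∃ k : ℕ, 2 ^ k • c = 0) → Nat.card Ct = 4 →
      ((AddSubgroup.zmultiples (Affine.Point.congrEquiv hcurve.symm
            (Affine.Point.map (W' := W.toAffine) (Algebra.ofId ℚ E) P)) ⊔ Ct) ⊔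
          (nsmulAddMonoidHom (2 ^ N) : ((W.baseChange K).baseChange E).toAffine.Point →+ _).range).index =
        2 ^ ℓ.toNat := by
  haveI : Fact (Nat.Prime 2) := ⟨Nat.prime_two⟩
  obtain ⟨Φ, hΦ⟩ := exists_pointEquiv_apply_toPadicPoint W 2 K E φ hφ hcurve
  obtain ⟨N₀, hN₀⟩ := index_zmultiples_toPadicPoint_sup_sup_range_eq hd hsq hd4 W hC hc₀ hker hℓ
  refine ⟨N₀, fun N hN Ct hCt hcard ↦ ?_⟩
  -- pull `C_t` back along `Φ`
  set Ct₀ : AddSubgroup (W.baseChange ℚ_[2]).toAffine.Point := Ct.comap Φ.toAddMonoidHom with hCt₀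
  have hmapC : Ct₀.map Φ.toAddMonoidHom = Ct := AddSubgroup.map_comap_eq_self_of_surjective Φ.surjective _
  have hCt₀' : ∀ c ∈ Ct₀, ∃ k : ℕ, 2 ^ k • c = 0 := fun c hc ↦ by
    obtain ⟨k, hk⟩ := hCt (Φ c) hc
    exact ⟨k, Φ.injective (by rw [map_nsmul, hk, map_zero])⟩
  have hcard₀ : Nat.card Ct₀ = 4 := by
    rw [← hcard, ← hmapC]
    exact Nat.card_congr (AddSubgroup.equivMapOfInjective Ct₀ Φ.toAddMonoidHom Φ.injective).toEquiv
  have h := hN₀ N hN Ct₀ hCt₀' hcard₀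
  -- transport the whole subgroup along `Φ`
  have hmap : ((AddSubgroup.zmultiples (W.toPadicPoint 2 P) ⊔ Ct₀) ⊔
        (nsmulAddMonoidHom (2 ^ N) : (W.baseChange ℚ_[2]).toAffine.Point →+ _).range).map Φ.toAddMonoidHom =
      (AddSubgroup.zmultiples (Affine.Point.congrEquiv hcurve.symm
            (Affine.Point.map (W' := W.toAffine) (Algebra.ofId ℚ E) P)) ⊔ Ct) ⊔
        (nsmulAddMonoidHom (2 ^ N) : ((W.baseChange K).baseChange E).toAffine.Point →+ _).range := by
    rw [AddSubgroup.map_sup, AddSubgroup.map_sup, AddMonoidHom.map_zmultiples, hmapC, AddEquiv.coe_toAddMonoidHom, hΦ P]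
    congr 1
    ext y
    simp only [AddSubgroup.mem_map, AddMonoidHom.mem_range, nsmulAddMonoidHom_apply, AddEquiv.coe_toAddMonoidHom]
    constructor
    · rintro ⟨x, ⟨z, rfl⟩, rfl⟩; exact ⟨Φ z, by rw [map_nsmul]⟩
    · rintro ⟨z, rfl⟩
      obtain ⟨z₀, rfl⟩ := Φ.surjective z
      exact ⟨2 ^ N • z₀, ⟨z₀, rfl⟩, by rw [map_nsmul]⟩
  rw [← hmap, AddSubgroup.index_map_eq _ Φ.surjective (fun x hx ↦ by
    rw [AddMonoidHom.mem_ker, AddEquiv.coe_toAddMonoidHom, Φ.map_eq_zero_iff] at hx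
    rw [hx]; exact AddSubgroup.zero_mem _)]
  exact h

end Summit.BirchSwinnertonDyer.BirchSwinnertonDyer.Theorems.PrintCf2.LocalLineCount

end
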